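import Summits.Ventures.LatticeQCDFlow.Exactness.FlowSamplerGroupSymmetrisationDirichlet
import Summits.Ventures.LatticeQCDFlow.Exactness.FlowSamplerOddObservableExact
import Summits.Ventures.LatticeQCDFlow.Exactness.Phi4FlowSquareIntegrableSticking
import HarnessLib

/-!
# Averaging a flow over a group makes `τ_int` EXACT on observables odd under one of its elements: `τ_int^{q̄}(g) = ½ + S_g(q̄) ≤ ½ + S_g(q̃) ≤ τ_int^{q̃}(g)`

HONEST FRAMING: exact (Metropolis-corrected) sampling algorithms for lattice gauge theory;
figures of merit are autocorrelation/cost numbers at stated couplings and volumes; no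
continuum-physics claim.  (SCALAR calibration rung S0-A: not a gauge result.)

Venture `LatticeQCDFlow` (cell pub-lqcd), topic `Exactness`; FANOUT row 2 (`s0-phi4`, FLOW arm;
group-averaged arm `q̄ = |G|⁻¹ Σ_a q̃ ∘ t_a` over a finite group of measure-preserving symmetries of the
target).  NEW WORK of the cell: the finite-group form of gen-22's `symmetrised_tauInt_eq_of_odd`
(there for the two-element group).  If `g` is odd under some group element `σ = t_{a₀}` (an involution in the examples, but
this is not needed) with `g²` invariant under the whole group (e.g. `g` in a sign sector with `χ(a₀) = −1`:
the magnetisation under any lattice group containing the flip; a staggered observable under a group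
containing the unit translation), then, because `q̄` is `σ`-symmetric (group law), the tree's exactness
for odd observables under symmetric models (`imhOp_tauInt_eq_of_odd`) applies to the AVERAGED arm:
its `τ_int(g)` is one half plus the `g²`-weighted mean number of consecutive rejections
`S_g(q̄) = ∫ g² w r_q̄/(1 − r_q̄) / ∫ g² w`, which is at most `S_g(q̃)` (`groupAvg_stickingColumn_le`),
which floors `τ_int^{q̃}(g)` (`imhOp_tauInt_ge_stickingSummed_of_sq`).  Nothing is cited as a fact.

## What is proved

* `groupAvg_symm_of_mem` — `q̄ ∘ t_{a₀} = q̄` (group law; no involution property needed);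
* **`groupAvg_tauInt_eq_of_odd`** — summable under `K_q̃` ⇒ under `K_q̄`: summable,
  `τ_int^{q̄}(g) = ½ + S_g(q̄)`, `S_g(q̄) ≤ S_g(q̃)`, and `½ + S_g(q̃) ≤ τ_int^{q̃}(g)` — so in particular
  `τ_int^{q̄}(g) ≤ τ_int^{q̃}(g)` with both ends of the chain EXPLICIT functionals of the per-configuration
  rejection probabilities (no chain needed to evaluate the averaged arm's `τ_int` of such `g`).

NOT CLAIMED: observables not odd under some group element (sign sectors with `χ ≢ 1` are covered); any value for any
network; cost accounting.  Lattice magnetisation instances (lag by lag, stronger) are in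
`Phi4FlowLatticeSymmetrisationMagnetisation`.
-/

namespace Summit.Ventures.LatticeQCDFlow.Exactness

open Real MeasureTheory Filter Finset Set Topology
open Summit.Ventures.LatticeQCDFlow.Scoring

section General

variable {X : Type*} [MeasurableSpace X] {μ : Measure X} [SFinite μ] {w q : X → ℝ}
  {G : Type*} [Fintype G] [Group G] {t : G → X ≃ᵐ X}

omit [MeasurableSpace X] in
/-- `q̄` is invariant under every group element `t_{a₀}`. -/
theorem groupAvg_symm_of_mem {t : G → X → X} (hmul : ∀ a b x, t (a * b) x = t a (t b x)) (a₀ : G)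
    (x : X) : (∑ a, q (t a (t a₀ x))) / Fintype.card G = (∑ a, q (t a x)) / Fintype.card G :=
  groupAvg_comp_symmetry hmul a₀ x

/-- **GROUP AVERAGING MAKES `τ_int` EXACT ON OBSERVABLES ODD UNDER A GROUP ELEMENT, AND NEVER LARGER
THAN THE FLOW'S.**  `G` finite acting by measure-preserving `t_a` (`t_{ab} = t_a ∘ t_b`,
`w ∘ t_a = w`), `a₀ ∈ G`; `w, q̃ > 0` measurable integrable, `∫ q̃ = 1`; `g` measurable,
`∫ g² w < ∞`, `g ∘ t_{a₀} = −g`, `g² ∘ t_a = g²` for all `a`; the normalised autocorrelation series of `g`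
under `imhOp μ w q̃` summable.  Then with `S(q) = ∫ g² w r_q/(1 − r_q)`, `P = ∫ g² w`:
the series under `imhOp μ w q̄` is summable, `τ_int^{q̄}(g) = ½ + S(q̄)/P`, `S(q̄) ≤ S(q̃)`, and
`½ + S(q̃)/P ≤ τ_int^{q̃}(g)`. -/
theorem groupAvg_tauInt_eq_of_odd (ht : ∀ a, MeasurePreserving (t a) μ μ)
    (hmul : ∀ a b x, t (a * b) x = t a (t b x)) (hw0 : ∀ x, 0 < w x) (hwm : Measurable w)
    (hwi : Integrable w μ) (hw : ∀ a x, w (t a x) = w x) (hq0 : ∀ x, 0 < q x) (hqm : Measurable q)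
    (hqi : Integrable q μ) (hq1 : ∫ z, q z ∂μ = 1) (a₀ : G)
    {g : X → ℝ} (hgm : Measurable g) (hg2 : Integrable (fun x => g x ^ 2 * w x) μ)
    (hodd : ∀ x, g (t a₀ x) = -g x) (hgsq : ∀ a x, g (t a x) ^ 2 = g x ^ 2)
    (hs : Summable fun n => (∫ x, g x * ((imhOp μ w q)^[n + 1] g) x * w x ∂μ)
      / ∫ x, g x ^ 2 * w x ∂μ) :
    (Summable fun n => (∫ x, g x * ((imhOp μ w (fun s => (∑ a, q (t a s)) / Fintype.card G))^[n + 1]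
        g) x * w x ∂μ) / ∫ x, g x ^ 2 * w x ∂μ) ∧
    tauInt (fun n => (∫ x, g x * ((imhOp μ w (fun s => (∑ a, q (t a s)) / Fintype.card G))^[n] g) x
        * w x ∂μ) / ∫ x, g x ^ 2 * w x ∂μ)
      = 1 / 2 + (∫ x, g x ^ 2 * w x
          * ((∫ z, (1 - imhAcceptQ w (fun s => (∑ a, q (t a s)) / Fintype.card G) x z)
                * ((∑ a, q (t a z)) / Fintype.card G) ∂μ)
            / (1 - ∫ z, (1 - imhAcceptQ w (fun s => (∑ a, q (t a s)) / Fintype.card G) x z)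
                * ((∑ a, q (t a z)) / Fintype.card G) ∂μ)) ∂μ) / ∫ x, g x ^ 2 * w x ∂μ ∧
    ∫ x, g x ^ 2 * w x
          * ((∫ z, (1 - imhAcceptQ w (fun s => (∑ a, q (t a s)) / Fintype.card G) x z)
                * ((∑ a, q (t a z)) / Fintype.card G) ∂μ)
            / (1 - ∫ z, (1 - imhAcceptQ w (fun s => (∑ a, q (t a s)) / Fintype.card G) x z)
                * ((∑ a, q (t a z)) / Fintype.card G) ∂μ)) ∂μ
      ≤ ∫ x, g x ^ 2 * w x * ((∫ z, (1 - imhAcceptQ w q x z) * q z ∂μ)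
          / (1 - ∫ z, (1 - imhAcceptQ w q x z) * q z ∂μ)) ∂μ ∧
    1 / 2 + (∫ x, g x ^ 2 * w x * ((∫ z, (1 - imhAcceptQ w q x z) * q z ∂μ)
          / (1 - ∫ z, (1 - imhAcceptQ w q x z) * q z ∂μ)) ∂μ) / ∫ x, g x ^ 2 * w x ∂μ
      ≤ tauInt (fun n => (∫ x, g x * ((imhOp μ w q)^[n] g) x * w x ∂μ) / ∫ x, g x ^ 2 * w x ∂μ) := by
  haveI : Nonempty G := ⟨a₀⟩
  obtain ⟨hs0, hsm, hsi, hs1⟩ := groupAvg_facts ht hq0 hqm hqi hq1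
  -- the flow arm's sticking column is finite (summability) and floors its `τ_int`
  obtain ⟨hSq, -⟩ := imhOp_integrable_stickingOdds_of_summable hw0 hwm hwi hq0 hqm hqi hq1 hgm hg2 hs
  have hfloor := imhOp_tauInt_ge_stickingSummed_of_sq hw0 hwm hwi hq0 hqm hqi hq1 hgm hg2 hs
  -- the averaged arm's sticking column is no larger
  obtain ⟨hSbar, hle⟩ := groupAvg_stickingColumn_le ht hw0 hwm hw hq0 hqm hqi hq1 hgm hgsq hSq
  -- exactness for the averaged arm: `q̄` is `t_{a₀}`-symmetric, `g` is `t_{a₀}`-odd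
  have hsym : ∀ x, (fun s => (∑ a, q (t a s)) / Fintype.card G) (t a₀ x)
      = (fun s => (∑ a, q (t a s)) / Fintype.card G) x := fun x =>
    groupAvg_symm_of_mem (q := q) (t := fun a => (t a : X → X)) hmul a₀ x
  obtain ⟨hsumbar, heq⟩ := imhOp_tauInt_eq_of_odd (μ := μ) (σ := fun x => t a₀ x) hw0 hwm hwi
    hs0 hsm hsi hs1 (fun F => integral_comp_symmetry ht a₀ F) (hw a₀) hsym hgm hg2 hodd hSbar
  exact ⟨hsumbar, heq, hle, hfloor⟩

/-- **COROLLARY: `τ_int^{q̄}(g) ≤ τ_int^{q̃}(g)`** for such `g`, the averaged value being the explicit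
`½ + S_g(q̄)/P`. -/
theorem groupAvg_tauInt_le_of_odd (ht : ∀ a, MeasurePreserving (t a) μ μ)
    (hmul : ∀ a b x, t (a * b) x = t a (t b x)) (hw0 : ∀ x, 0 < w x) (hwm : Measurable w)
    (hwi : Integrable w μ) (hw : ∀ a x, w (t a x) = w x) (hq0 : ∀ x, 0 < q x) (hqm : Measurable q)
    (hqi : Integrable q μ) (hq1 : ∫ z, q z ∂μ = 1) (a₀ : G)
    {g : X → ℝ} (hgm : Measurable g) (hg2 : Integrable (fun x => g x ^ 2 * w x) μ)
    (hP : 0 < ∫ x, g x ^ 2 * w x ∂μ) (hodd : ∀ x, g (t a₀ x) = -g x)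
    (hgsq : ∀ a x, g (t a x) ^ 2 = g x ^ 2)
    (hs : Summable fun n => (∫ x, g x * ((imhOp μ w q)^[n + 1] g) x * w x ∂μ)
      / ∫ x, g x ^ 2 * w x ∂μ) :
    tauInt (fun n => (∫ x, g x * ((imhOp μ w (fun s => (∑ a, q (t a s)) / Fintype.card G))^[n] g) x
        * w x ∂μ) / ∫ x, g x ^ 2 * w x ∂μ)
      ≤ tauInt (fun n => (∫ x, g x * ((imhOp μ w q)^[n] g) x * w x ∂μ) / ∫ x, g x ^ 2 * w x ∂μ) := by
  obtain ⟨-, heq, hle, hfloor⟩ := groupAvg_tauInt_eq_of_odd ht hmul hw0 hwm hwi hw hq0 hqm hqi hq1 a₀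
    hgm hg2 hodd hgsq hs
  rw [heq]
  have h := div_le_div_of_nonneg_right hle hP.le
  linarith

end General

end Summit.Ventures.LatticeQCDFlow.Exactness
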